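import Summits.QuantumFields.YangMills.Theorems.LuscherReductionRunningReductionInnerCopiesForm
import Summits.QuantumFields.YangMills.Theorems.LuscherReductionRunningReductionCoarseUpperCopies
import Summits.QuantumFields.YangMills.Theorems.LuscherReductionRunningReductionCoarseUpperScales
import Summits.QuantumFields.YangMills.Theorems.FemtoCutoffLadderFixedLatticeLawOffTube
import HarnessLib

/-!
# Route `FlatTubeReduction` (K1 `NearFlatRatioLaw`, items 24720 / 27141; pool `FixedLatticeLaw` 23943): the REAL-ARITHMETIC ENDGAME of the
# two-layer onion for the ground state (rung R2b1 = RECORD-label femto gap; no summit statement is proved here)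

Seat `ym-line-ftr-p1` g4 (prover).  Pure real-number bookkeeping used by `…GroundStateConcentration`: the two-layer recursion
(`two_layer_arith`), «a stretched exponential beats every polynomial» (`superpoly_small`, from `exists_poly_le_exp_rpow`), the cross-copy
kernel bound in units of the free row sum (`crossBound_le_poly_latCE`, from `latCE_ge_poly`), `u/2 ≤ 1 − e^{−u}`, and ★ `endgame_real`: the five
smallness conditions of `two_layer_arith` at the scales `u = c_L β^{−1/3}`, `ρ = β^{−1/39}`, `η = β^{−17/20}`, gain `γ ≥ u/2`, floor `λ₀ ≥ f·c_β^{|E|}`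
(main term `(a ε₁)(a ε₂) ≍ β^{−144/117} ≤ 1/(2β)`, all others stretched-exponentially small).
HONEST FRAMING: elementary inequalities; nothing here is infinite volume, a continuum limit or the Clay mass gap.  No definitions, no named facts, no `sorry`.
References: B. Simon, Ann. Phys. 146 (1983) 209 [cite: SimonB1983DiscreteSpectrum, §3]; M. Lüscher, NPB 219 (1983) 233 [cite: Luscher1983, §2].
-/

set_option autoImplicit false

noncomputable section

open MeasureTheory Filter Topology Real
open scoped Matrix BigOperators
open Literature.MathematicalPhysics.QuantumFieldTheory hiding SU2
open Literature.MathematicalPhysics.QuantumLattice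

namespace Summit.QuantumFields.YangMills.Theorems.FemtoTransferGap

namespace GroundConc

open Summit.QuantumFields.YangMills.Theorems.FemtoCutoffLadder

variable {L : ℕ} [NeZero L]
/-! ## §5 Two layers: the outer mass of the ground state is `≤ ‖Ω‖²/β` -/

/-- Pure arithmetic of the two-layer onion. [folklore] -/
theorem two_layer_arith {N X₁ X₂ a cb e₁ e₂ k t β : ℝ} (hN : 0 ≤ N) (hβ : 0 < β)
    (ha : 0 ≤ a) (hcb : 0 ≤ cb) (he₂ : 0 ≤ e₂) (hk : 0 ≤ k) (ht : 0 ≤ t)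
    (hX1 : X₁ ≤ a * (cb * N + e₁ * N + k * N) + t * N)
    (hX2 : X₂ ≤ a * (cb * N + e₂ * X₁ + k * N) + t * N)
    (hmain : (a * e₁) * (a * e₂) ≤ 1 / (2 * β)) (he₂' : a * e₂ ≤ 1)
    (hcb' : a * cb ≤ 1 / (16 * β)) (hk' : a * k ≤ 1 / (16 * β)) (ht' : t ≤ 1 / (16 * β)) :
    X₂ ≤ N / β := by
  have hae₂ : 0 ≤ a * e₂ := mul_nonneg ha he₂
  have h1 : a * e₂ * X₁ ≤ a * e₂ * (a * (cb * N + e₁ * N + k * N) + t * N) := mul_le_mul_of_nonneg_left hX1 hae₂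
  have h2 : a * e₂ * (a * (cb * N + e₁ * N + k * N) + t * N)
      = ((a * e₁) * (a * e₂)) * N + (a * e₂) * ((a * cb + a * k + t) * N) := by ring
  have h3 : (a * e₂) * ((a * cb + a * k + t) * N) ≤ 1 * ((a * cb + a * k + t) * N) :=
    mul_le_mul_of_nonneg_right he₂' (by positivity)
  have h4 : ((a * e₁) * (a * e₂)) * N ≤ 1 / (2 * β) * N := mul_le_mul_of_nonneg_right hmain hN
  have h5 : (a * cb + a * k + t) * N ≤ (3 / (16 * β)) * N := by
    refine mul_le_mul_of_nonneg_right ?_ hN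
    have : (3 : ℝ) / (16 * β) = 1 / (16 * β) + 1 / (16 * β) + 1 / (16 * β) := by ring
    linarith
  have h6 : X₂ ≤ (a * cb + a * k + t) * N + a * e₂ * X₁ := by nlinarith [hX2]
  have h7 : (1 / (2 * β) + 2 * (3 / (16 * β))) * N ≤ N / β := by
    have e : (1 / (2 * β) + 2 * (3 / (16 * β))) = (7 / 8) / β := by field_simp; ring
    rw [e, div_mul_eq_mul_div, mul_comm, ← mul_div_assoc]
    exact div_le_div_of_nonneg_right (by nlinarith) hβ.le
  nlinarith [h1, h2, h3, h4, h5, h6, h7]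

/-- A stretched exponential beats every polynomial: `C·β^N·e^{−cβ^s} ≤ ε` eventually (`c, s, ε > 0`). [folklore] -/
theorem superpoly_small (C : ℝ) (N : ℕ) {c s ε : ℝ} (hc : 0 < c) (hs : 0 < s) (hε : 0 < ε) :
    ∃ β0 : ℝ, ∀ β : ℝ, β0 ≤ β → 1 ≤ β ∧ C * β ^ N * Real.exp (-(c * β ^ s)) ≤ ε := by
  obtain ⟨β1, hβ1, h1⟩ := exists_poly_le_exp_rpow (C / ε) N (s := s / 2) (by positivity)
  obtain ⟨β2, h2⟩ := rpow_neg_eventually_le (q := s / 2) (M := 2 * c) (by positivity) (by positivity)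
  refine ⟨max β1 β2, fun β hβ => ?_⟩
  have hb1 : β1 ≤ β := (le_max_left _ _).trans hβ
  obtain ⟨hβone, hneg⟩ := h2 β ((le_max_right _ _).trans hβ)
  have hβ0 : 0 < β := by linarith
  refine ⟨hβone, ?_⟩
  have hA := h1 β hb1
  -- `β^{s/2}/2 ≤ c β^s`
  have hpos : 0 < β ^ (s / 2) := Real.rpow_pos_of_pos hβ0 _
  have hge : 1 ≤ 2 * c * β ^ (s / 2) := by
    rw [Real.rpow_neg hβ0.le] at hneg
    have := (inv_le_iff_one_le_mul₀ hpos).1 hneg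
    linarith
  have hsq : β ^ s = β ^ (s / 2) * β ^ (s / 2) := by
    rw [← Real.rpow_add hβ0]; congr 1; ring
  have hle : β ^ (s / 2) / 2 ≤ c * β ^ s := by
    rw [hsq]
    have : β ^ (s / 2) / 2 = (1 / 2) * β ^ (s / 2) := by ring
    rw [this, ← mul_assoc]
    nlinarith
  have hexp : Real.exp (β ^ (s / 2) / 2) ≤ Real.exp (c * β ^ s) := Real.exp_le_exp.2 hle
  have hE0 : 0 < Real.exp (c * β ^ s) := Real.exp_pos _
  have h3 : C / ε * β ^ N ≤ Real.exp (c * β ^ s) := hA.trans hexp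
  rw [Real.exp_neg]
  rw [div_mul_eq_mul_div, div_le_iff₀ hε] at h3
  calc C * β ^ N * (Real.exp (c * β ^ s))⁻¹ = C * β ^ N / Real.exp (c * β ^ s) := by rw [div_eq_mul_inv]
    _ ≤ ε := by rw [div_le_iff₀ hE0]; linarith

/-- `crossBound L β R ≤ (4β²/w)^{|E|} · e^{−(β/2)R²/|E|} · c_β^{|E|}` for `β ≥ 1` (`w = e^{−1/2}·8/(3π³)`; the polynomial floor of the free row sum). [folklore] -/
theorem crossBound_le_poly_latCE {β : ℝ} (hβ : 1 ≤ β) (R : ℝ) :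
    crossBound L β R ≤
      (4 * β ^ 2 / (Real.exp (-(1 / 2 : ℝ)) * (8 / (3 * π ^ 3)))) ^ Fintype.card (Edge 3 L) *
        Real.exp (-(β / 2 * (R ^ 2 / Fintype.card (Edge 3 L)))) * latCE L β := by
  set w : ℝ := Real.exp (-(1 / 2 : ℝ)) * (8 / (3 * π ^ 3)) with hw
  have hw0 : 0 < w := by rw [hw]; positivity
  have hβ0 : 0 < β := by linarith
  have hlat := latCE_ge_poly (L := L) hβ
  set n := Fintype.card (Edge 3 L) with hn
  have e1 : Real.exp (2 * β) ^ n = (Real.exp (2 * β) * (w / (4 * β ^ 2))) ^ n * (4 * β ^ 2 / w) ^ n := by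
    rw [← mul_pow]; congr 1; field_simp
  unfold crossBound
  rw [e1]
  have hA : (Real.exp (2 * β) * (w / (4 * β ^ 2))) ^ n ≤ latCE L β := by
    have : Real.exp (2 * β) * (w / (4 * β ^ 2)) = Real.exp (2 * β) * (Real.exp (-(1 / 2 : ℝ)) * (8 / (3 * π ^ 3)) / (4 * β ^ 2)) := by
      rw [hw]
    rw [this]; exact hlat
  have hB : 0 ≤ (4 * β ^ 2 / w) ^ n * Real.exp (-(β / 2 * (R ^ 2 / n))) := by positivity
  calc (Real.exp (2 * β) * (w / (4 * β ^ 2))) ^ n * (4 * β ^ 2 / w) ^ n * Real.exp (-(β / 2 * (R ^ 2 / n)))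
      = (Real.exp (2 * β) * (w / (4 * β ^ 2))) ^ n * ((4 * β ^ 2 / w) ^ n * Real.exp (-(β / 2 * (R ^ 2 / n)))) := by ring
    _ ≤ latCE L β * ((4 * β ^ 2 / w) ^ n * Real.exp (-(β / 2 * (R ^ 2 / n)))) := mul_le_mul_of_nonneg_right hA hB
    _ = (4 * β ^ 2 / w) ^ n * Real.exp (-(β / 2 * (R ^ 2 / n))) * latCE L β := by ring


/-- The real-arithmetic ENDGAME of the two-layer onion: the five smallness conditions of `two_layer_arith` from the scale relations
`u = c_L β^{−1/3}`, `ρ = β^{−1/39}`, `η = β^{−17/20}`, `γ ≥ u/2`, `λ₀ ≥ f·c_β^{|E|}` and the five eventual inequalities. [folklore] -/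
theorem endgame_real (n : ℕ) {β f w lat lam u cL ρ η γ L3 cb : ℝ}
    (hβ1 : 1 ≤ β) (hn : 0 < (n : ℝ)) (hf : 0 < f) (hw : 0 < w) (hlat : 0 < lat) (hlamf : f * lat ≤ lam)
    (hu0 : 0 < u) (hcL : 0 < cL) (hu : u = cL * β ^ (-(1 : ℝ) / 3)) (hL3 : 0 < L3) (hinvu : 1 / u ≤ L3 * β)
    (hρ : ρ = β ^ (-(1 / 39 : ℝ))) (hη : η = β ^ (-(17 / 20 : ℝ))) (hγu : u / 2 ≤ γ)
    (hcb0 : 0 ≤ cb) (hcb : cb ≤ (4 / w) ^ n * β ^ (2 * n) * Real.exp (-(1 / (8 * n) * β ^ ((37 : ℝ) / 39))) * lat)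
    (h1 : 2 * ((6 * (n : ℝ) ^ 2 * (8 * π) ^ 2 / f) / cL) ^ 2 + 4 ≤ β ^ ((27 : ℝ) / 117) / 2)
    (h2 : (6 * (n : ℝ) ^ 2 * (8 * π) ^ 2 / f) / cL + 4 ≤ β ^ ((72 : ℝ) / 117) / 2)
    (h3 : 16 * (4 * L3 / f) * (4 / w) ^ n * β ^ (2 * n + 2) * Real.exp (-(1 / (8 * n) * β ^ ((37 : ℝ) / 39))) ≤ 1)
    (h4 : 16 * (4 * L3 / f) * (1 + 4 * L3) * β ^ 3 * Real.exp (-(β ^ ((3 : ℝ) / 20))) ≤ 1)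
    (h5 : 16 / f * β * Real.exp (-(β ^ ((3 : ℝ) / 20))) ≤ 1) :
    (2 / (γ * lam) * ((1 / 2) * ((n : ℝ) ^ 2 * (8 * π / ρ) ^ 2 * (3 / β) * lat))) *
        (2 / (γ * lam) * ((1 / 2) * ((n : ℝ) ^ 2 * (8 * π / (3 * ρ)) ^ 2 * (3 / β) * lat))) ≤ 1 / (2 * β) ∧
      2 / (γ * lam) * ((1 / 2) * ((n : ℝ) ^ 2 * (8 * π / (3 * ρ)) ^ 2 * (3 / β) * lat)) ≤ 1 ∧
      2 / (γ * lam) * cb ≤ 1 / (16 * β) ∧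
      2 / (γ * lam) * ((1 + 2 / γ) * (Real.exp (-(β * η)) * lat)) ≤ 1 / (16 * β) ∧
      Real.exp (-(β * η)) * lat / lam ≤ 1 / (16 * β) := by
  have hβ0 : 0 < β := by linarith
  have hββ : ∀ x : ℝ, β * β ^ x = β ^ (1 + x) := fun x => by rw [Real.rpow_add hβ0, Real.rpow_one]
  have hρ0 : 0 < ρ := by rw [hρ]; exact Real.rpow_pos_of_pos hβ0 _
  have h3ρ0 : 0 < 3 * ρ := by positivity
  have hγ0 : 0 < γ := by linarith
  have hlam0 : 0 < lam := lt_of_lt_of_le (by positivity) hlamf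
  set K₀ : ℝ := 6 * (n : ℝ) ^ 2 * (8 * π) ^ 2 / f with hK₀
  have hK₀0 : 0 < K₀ := by positivity
  set a : ℝ := 2 / (γ * lam) with hadef
  have ha0 : 0 ≤ a := by positivity
  set e₁ : ℝ := (1 / 2) * ((n : ℝ) ^ 2 * (8 * π / ρ) ^ 2 * (3 / β) * lat) with he₁
  set e₂ : ℝ := (1 / 2) * ((n : ℝ) ^ 2 * (8 * π / (3 * ρ)) ^ 2 * (3 / β) * lat) with he₂
  have he₂0 : 0 ≤ e₂ := by positivity
  have he₂1 : e₂ ≤ e₁ := by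
    rw [he₁, he₂]
    have h1 : 8 * π / (3 * ρ) ≤ 8 * π / ρ := div_le_div_of_nonneg_left (by positivity) hρ0 (by linarith)
    gcongr
  -- `a ≤ 4/(u f lat)`
  have ha_le : a ≤ 4 / (u * (f * lat)) := by
    rw [hadef, div_le_div_iff₀ (by positivity) (by positivity)]
    have : u * (f * lat) ≤ (2 * γ) * lam := mul_le_mul (by linarith) hlamf (by positivity) (by positivity)
    linarith
  -- the key quantity `A = K₀/(uρ²β) = (K₀/cL)·β^{−72/117}`
  have hM : u * ρ ^ 2 * β = cL * β ^ ((72 : ℝ) / 117) := by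
    rw [hu, hρ, ← Real.rpow_mul_natCast hβ0.le]
    have e : cL * β ^ (-(1 : ℝ) / 3) * β ^ (-(1 / 39 : ℝ) * (2 : ℕ)) * β
        = cL * (β * β ^ (-(1 : ℝ) / 3) * β ^ (-(1 / 39 : ℝ) * (2 : ℕ))) := by ring
    rw [e, hββ, ← Real.rpow_add hβ0]
    norm_num
  have hM0 : 0 < u * ρ ^ 2 * β := by positivity
  have hae : a * e₁ ≤ K₀ / (u * ρ ^ 2 * β) := by
    calc a * e₁ ≤ 4 / (u * (f * lat)) * e₁ := mul_le_mul_of_nonneg_right ha_le (by positivity)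
      _ = K₀ / (u * ρ ^ 2 * β) := by
          rw [he₁, hK₀]
          field_simp
          ring
  have hAsq : (K₀ / (u * ρ ^ 2 * β)) ^ 2 ≤ 1 / (2 * β) := by
    rw [hM]
    have hβa : 2 * (K₀ / cL) ^ 2 ≤ β ^ ((27 : ℝ) / 117) := by
      have h' := (le_div_iff₀ (by norm_num : (0 : ℝ) < 2)).1 h1
      exact le_trans (by linarith [sq_nonneg (K₀ / cL)]) h'
    rw [div_pow, mul_pow, div_le_div_iff₀ (by positivity) (by positivity)]
    have e2 : (β ^ ((72 : ℝ) / 117)) ^ 2 = β ^ ((27 : ℝ) / 117) * β := by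
      rw [← Real.rpow_mul_natCast hβ0.le, mul_comm (β ^ ((27 : ℝ) / 117)) β, hββ]
      norm_num
    rw [e2]
    have h3 : K₀ ^ 2 * 2 ≤ cL ^ 2 * β ^ ((27 : ℝ) / 117) := by
      have h4 := mul_le_mul_of_nonneg_left hβa (sq_nonneg cL)
      have e3 : cL ^ 2 * (2 * (K₀ / cL) ^ 2) = K₀ ^ 2 * 2 := by field_simp
      rw [e3] at h4
      exact h4
    generalize β ^ ((27 : ℝ) / 117) = s at h3 ⊢
    calc K₀ ^ 2 * (2 * β) = (K₀ ^ 2 * 2) * β := by ring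
      _ ≤ (cL ^ 2 * s) * β := mul_le_mul_of_nonneg_right h3 hβ0.le
      _ = 1 * (cL ^ 2 * (s * β)) := by ring
  have hA1 : K₀ / (u * ρ ^ 2 * β) ≤ 1 := by
    rw [hM, div_le_one (by positivity)]
    have h' := (le_div_iff₀ (by norm_num : (0 : ℝ) < 2)).1 h2
    have hKc : 0 ≤ K₀ / cL := by positivity
    have hβa : K₀ / cL ≤ β ^ ((72 : ℝ) / 117) := le_trans (by linarith) h'
    rw [div_le_iff₀ hcL] at hβa
    generalize β ^ ((72 : ℝ) / 117) = s at hβa ⊢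
    linarith
  have hmain : (a * e₁) * (a * e₂) ≤ 1 / (2 * β) := by
    have h1 : a * e₂ ≤ a * e₁ := mul_le_mul_of_nonneg_left he₂1 ha0
    have h2 : 0 ≤ a * e₂ := mul_nonneg ha0 he₂0
    calc (a * e₁) * (a * e₂) ≤ (K₀ / (u * ρ ^ 2 * β)) * (K₀ / (u * ρ ^ 2 * β)) :=
          mul_le_mul hae (h1.trans hae) h2 ((h2.trans h1).trans hae)
      _ = (K₀ / (u * ρ ^ 2 * β)) ^ 2 := (sq _).symm
      _ ≤ 1 / (2 * β) := hAsq
  have he₂' : a * e₂ ≤ 1 := ((mul_le_mul_of_nonneg_left he₂1 ha0).trans hae).trans hA1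
  -- the super-polynomially small terms
  have hexp2 : β * η = β ^ ((3 : ℝ) / 20) := by rw [hη, hββ]; norm_num
  have hcb' : a * cb ≤ 1 / (16 * β) := by
    set X : ℝ := (4 / w) ^ n * β ^ (2 * n) * Real.exp (-(1 / (8 * n) * β ^ ((37 : ℝ) / 39))) with hX
    have hX0 : 0 ≤ X := by positivity
    have h1 : a * cb ≤ 4 / (u * (f * lat)) * (X * lat) := mul_le_mul ha_le hcb hcb0 (by positivity)
    have h2 : 4 / (u * (f * lat)) * (X * lat) = (4 * (1 / u) / f) * X := by field_simp
    rw [h2] at h1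
    have h3' : 4 * (1 / u) / f ≤ 4 * (L3 * β) / f := div_le_div_of_nonneg_right (by linarith) hf.le
    have h4' : a * cb ≤ 4 * (L3 * β) / f * X := h1.trans (mul_le_mul_of_nonneg_right h3' hX0)
    rw [le_div_iff₀ (by positivity)]
    have h5' : a * cb * (16 * β) ≤ 4 * (L3 * β) / f * X * (16 * β) := mul_le_mul_of_nonneg_right h4' (by positivity)
    have e : 16 * (4 * L3 / f) * (4 / w) ^ n * β ^ (2 * n + 2) * Real.exp (-(1 / (8 * n) * β ^ ((37 : ℝ) / 39)))
        = 4 * (L3 * β) / f * X * (16 * β) := by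
      rw [hX, pow_add]; ring
    rw [e] at h3
    exact h5'.trans h3
  have hk' : a * ((1 + 2 / γ) * (Real.exp (-(β * η)) * lat)) ≤ 1 / (16 * β) := by
    have hγ' : 2 / γ ≤ 4 * (1 / u) := by
      rw [div_le_iff₀ hγ0]
      have e : 4 * (1 / u) * γ = 4 * γ / u := by ring
      rw [e, le_div_iff₀ hu0]; linarith
    have hE0 : 0 < Real.exp (-(β * η)) := Real.exp_pos _
    have h1 : (1 + 2 / γ) * (Real.exp (-(β * η)) * lat) ≤ (1 + 4 * (1 / u)) * (Real.exp (-(β * η)) * lat) :=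
      mul_le_mul_of_nonneg_right (by linarith) (by positivity)
    have h2 : a * ((1 + 2 / γ) * (Real.exp (-(β * η)) * lat)) ≤ 4 / (u * (f * lat)) * ((1 + 4 * (1 / u)) * (Real.exp (-(β * η)) * lat)) :=
      mul_le_mul ha_le h1 (by positivity) (by positivity)
    have h3' : 4 / (u * (f * lat)) * ((1 + 4 * (1 / u)) * (Real.exp (-(β * η)) * lat))
        = 4 * (1 / u) / f * (1 + 4 * (1 / u)) * Real.exp (-(β * η)) := by field_simp
    rw [h3'] at h2
    have h4' : 4 * (1 / u) / f * (1 + 4 * (1 / u)) ≤ 4 * (L3 * β) / f * (1 + 4 * (L3 * β)) :=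
      mul_le_mul (div_le_div_of_nonneg_right (by linarith) hf.le) (by linarith) (by positivity) (by positivity)
    have h5' : 4 * (L3 * β) / f * (1 + 4 * (L3 * β)) ≤ (4 * L3 / f) * (1 + 4 * L3) * β ^ 2 := by
      have hb : 1 + 4 * (L3 * β) ≤ (1 + 4 * L3) * β := by
        have e' : (1 + 4 * L3) * β = β + 4 * (L3 * β) := by ring
        rw [e']; linarith
      have e : 4 * (L3 * β) / f * ((1 + 4 * L3) * β) = (4 * L3 / f) * (1 + 4 * L3) * β ^ 2 := by ring
      rw [← e]; exact mul_le_mul_of_nonneg_left hb (by positivity)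
    have h6 : a * ((1 + 2 / γ) * (Real.exp (-(β * η)) * lat)) ≤ (4 * L3 / f) * (1 + 4 * L3) * β ^ 2 * Real.exp (-(β * η)) :=
      h2.trans (mul_le_mul_of_nonneg_right (h4'.trans h5') hE0.le)
    have h4'' : 16 * (4 * L3 / f) * (1 + 4 * L3) * β ^ 3 * Real.exp (-(β * η)) ≤ 1 := by rw [hexp2]; exact h4
    rw [le_div_iff₀ (by positivity)]
    have h7 := mul_le_mul_of_nonneg_right h6 (show (0 : ℝ) ≤ 16 * β by positivity)
    have e : (4 * L3 / f) * (1 + 4 * L3) * β ^ 2 * Real.exp (-(β * η)) * (16 * β)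
        = 16 * (4 * L3 / f) * (1 + 4 * L3) * β ^ 3 * Real.exp (-(β * η)) := by ring
    generalize Real.exp (-(β * η)) = X at h7 e h4'' ⊢
    linarith [h7, e, h4'']
  have ht' : Real.exp (-(β * η)) * lat / lam ≤ 1 / (16 * β) := by
    have h1 : Real.exp (-(β * η)) * lat / lam ≤ Real.exp (-(β * η)) * lat / (f * lat) :=
      div_le_div_of_nonneg_left (by positivity) (by positivity) hlamf
    have h2 : Real.exp (-(β * η)) * lat / (f * lat) = Real.exp (-(β ^ ((3 : ℝ) / 20))) / f := by
      rw [hexp2]; field_simp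
    rw [h2] at h1
    rw [le_div_iff₀ (by positivity)]
    have h3' := mul_le_mul_of_nonneg_right h1 (show (0 : ℝ) ≤ 16 * β by positivity)
    have e : Real.exp (-(β ^ ((3 : ℝ) / 20))) / f * (16 * β) = 16 / f * β * Real.exp (-(β ^ ((3 : ℝ) / 20))) := by
      field_simp
    generalize Real.exp (-(β ^ ((3 : ℝ) / 20))) = X at h3' e h5 ⊢
    linarith [h3', e, h5]
  exact ⟨hmain, he₂', hcb', hk', ht'⟩

end GroundConc

end Summit.QuantumFields.YangMills.Theorems.FemtoTransferGap

end
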